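import Literature.IUT.LogVolume.TensorPacketContentExact
import Literature.IUT.LogVolume.TensorPacketContentSharp
import Literature.IUT.LogVolume.TensorPacketLicenceCellInhabited
import HarnessLib

/-!
# The (Ind2)-orbit hull of a bare Θ-box: the ECCENTRICITY of the factor log-shells is paid on top of the different —
# `log‖g‖ + (d_I − d_{L_J})·log p + Σ_i log(‖z_i‖/‖c_i‖) ≤ log μ̄(hull(⋃_{γ∈Ind2} γ·M))` ([IUTchIV] Prop. 1.2; Dupuy–Hilado §4.9–4.12)

Proof-only file (theorems, no definitions, no named facts) of the abc-iut cell (WAVE-3 discharge seat abc-iut-c312-d1, gen 9;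
row «C:PERIMAGE-SHELL»). Classical `p`-adic lattice algebra over the cell's REAL packet definitions; TAKES NO SIDE on
[IUTchIII] Cor. 3.12.

abc-iut-w5-d180's orbit formula (`TensorPacketOrbitVolume.exists_packetLogμ_packetHull_orbit_eq`) says that for a bounded
region `M ⊄ {0}` of the packet `V = ⊗_{ℚ_p} k_i` with CONTENT `m` in the tensor log-shell `Λ = log_p(R_I^×)`

  `log μ̄(hull(⋃_{γ ∈ Ind2} γ·M)) = −m·log p + H`,  `H = log μ̄(hull(Λ)) = Σ_i log‖z_i^max‖` (abc-iut-w5-d082),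

and abc-iut-c312-5's content criterion (`TensorPacketContentExact.iota_smul_normalizedPacket_subset_zpow_smul_logPacket_iff`)
bounds the content of a bare box `ι_i(g)·(R_I)^∼ ⊆ M` through the LARGEST INNER BALLS `c_i·R_i ⊆ log_p(R_i^×)`:
`m·log p ≤ −log‖g‖ − (d_I − d_{L_J})·log p + Σ_i log‖c_i‖` for every factor `L_J`. abc-iut-w6-d018's sharp lower end
(`TensorPacketContentSharp.packetLogμ_packetHull_orbit_ge_sharp`) used a DOMINATING family instead (`‖c_i‖ ≥ ‖z_i^max‖`), for
which the shell term cancels against `H`. HERE the two are combined: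

* **`packetLogμ_packetHull_orbit_ge_shell`** — for largest inner balls `c_i` and ANY nonzero `z_i ∈ log_p(R_i^×)`:
  `log‖g‖ + (d_I − d_{L_J})·log p + Σ_i (log‖z_i‖ − log‖c_i‖) ≤ log μ̄(hull(⋃_γ γ·M))` — the orbit hull pays, beyond the
  different, the log-ratio of an attained outer radius to the inner radius of EVERY factor shell (`≥ 0`; `= 0` at tame
  factors, where `log_p(R_i^×) = 𝔪_i` is a ball);
* `exists_shellPair_nonneg` — at every factor such a pair `(c, z)` exists with `log‖z‖ − log‖c‖ ≥ 0` (abc-iut-W-row-2's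
  `exists_shellRadii_witnesses`);
* **`exists_shellPair_ge_of_forall_ne`** — OFF THE CYCLOTOMIC INDICES (`e ≠ p^a·(p−1)` for all `a`) the pair can be taken with
  `log‖z‖ − log‖c‖ ≥ (a − (p^a − 1)/e)·log p` for EVERY `a : ℕ`: the inner radius is `≤ p^{−1/e}` (the unit ball is never inside
  `log_p(𝒪^×)`, abc-iut-W-row-2's `not_closedBall_one_subset_logUnits` / `norm_le_rpow_of_mul_subset_logUnits`) and
  `‖log_p(1 + ϖ)‖ = p^{−(p^{a₀} − e·a₀)/e} ≥ p^{a − p^a/e}` (abc-iut-c312-3's envelope `LogEnvelope.exists_mem_logUnits_norm_eq_envelope`,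
  `envelope_le_index`).

[cite: Mochizuki2012, IUTchIV Prop. 1.1 p. 9, Prop. 1.2 (i)(ii) p. 10, Prop. 1.4 (iii) p. 13] [cite: DupuyHilado2025, §4.9, §4.12]
[cite: NeukirchANT1999, Ch. II (5.5)] (Ind2)/the hull are the tree's typings of disputed-corpus constructions
[claim: Mochizuki2012, status: disputed]; nothing here takes a side on [IUTchIII] Cor. 3.12. PROOF-ONLY.
-/

noncomputable section

open Set Module Metric
open scoped Pointwise TensorProduct

namespace Literature.IUT.LogVolume

open Literature.NumberTheory.GaloisRepresentations.Ultrametric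

/-! ## 1. Packet level: different AND shell eccentricity -/

section Packet

variable (p : ℕ) [Fact p.Prime]
variable {I : Type} [Fintype I] [DecidableEq I] [Nonempty I]
variable (k : I → Type) [∀ i, NontriviallyNormedField (k i)] [∀ i, NormedAlgebra ℚ_[p] (k i)]
  [∀ i, IsUltrametricDist (k i)] [∀ i, ProperSpace (k i)]

/-- **THE ORBIT HULL PAYS THE DIFFERENT AND THE SHELL ECCENTRICITY.** For largest inner balls `c_i·R_i ⊆ log_p(R_i^×)`
(`c_i ≠ 0`, maximal: some `w ∉ log_p(R_i^×)` with `‖w‖·‖ϖ_i‖ ≤ ‖c_i‖`), any nonzero `z_i ∈ log_p(R_i^×)`, a bounded region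
`M ⊇ ι_i(g)·(R_I)^∼` (`g ≠ 0`) and every factor `L_J`:
`log‖g‖ + (d_I − d_{L_J})·log p + Σ_i (log‖z_i‖ − log‖c_i‖) ≤ log μ̄(hull(⋃_{γ∈Ind2} γ·M))`.
[cite: Mochizuki2012, IUTchIV Prop. 1.2 (i)(ii) p. 10] [cite: DupuyHilado2025, §4.9, §4.12] -/
theorem packetLogμ_packetHull_orbit_ge_shell {c : Π i, k i} (hc0 : ∀ i, c i ≠ 0)
    (hc : ∀ i (o : k i), ‖o‖ ≤ 1 → c i * o ∈ logUnits (k i))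
    (hmax : ∀ i, ∃ (ϖ : (k i)ˣ) (w : k i), IsUniformizer ϖ ∧ w ∉ logUnits (k i) ∧ ‖w‖ * ‖(ϖ : k i)‖ ≤ ‖c i‖)
    {z : Π i, k i} (hz0 : ∀ i, z i ≠ 0) (hzΛ : ∀ i, z i ∈ logUnits (k i))
    {M : Set (PacketAlgebra p k)} (hMb : IsPsiBounded p k M) {i : I} {g : k i} (hg0 : g ≠ 0)
    (hgM : iota p k i g • (normalizedPacket p k : Set (PacketAlgebra p k)) ⊆ M) (J : DIdx p k) :
    Real.log ‖g‖ + (dSum p k - differentOrd p (DFac p k J)) * Real.log p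
        + ∑ i, (Real.log ‖z i‖ - Real.log ‖c i‖) ≤
      packetLogμ p k (packetHull p k (⋃ γ : indTwo p k, γ • M)) := by
  have hp : p.Prime := Fact.out
  have hp1 : (1 : ℝ) < p := by exact_mod_cast hp.one_lt
  have hp0 : (0 : ℝ) < p := by linarith
  have hM0 : ∃ x ∈ M, x ≠ 0 :=
    ⟨_, hgM (Set.smul_mem_smul_set (normalizedPacket p k).one_mem),
      by rw [smul_eq_mul, mul_one]; exact (map_ne_zero (iota p k i)).mpr hg0⟩
  obtain ⟨m, hm, -, -, hvol⟩ := exists_packetLogμ_packetHull_orbit_eq p k hMb hM0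
  -- the content bound through the largest inner balls (abc-iut-c312-5)
  have hsub : iota p k i g • (normalizedPacket p k : Set (PacketAlgebra p k)) ⊆
      ((p : ℚ_[p]) ^ m) • (logPacket p k : Set (PacketAlgebra p k)) := hgM.trans hm
  have hJ := (iota_smul_normalizedPacket_subset_zpow_smul_logPacket_iff p k hc0 hc hmax i g m).mp hsub J
  have hgpos : 0 < ‖g‖ := norm_pos_iff.mpr hg0
  have hcpos : ∀ i, 0 < ‖c i‖ := fun i => norm_pos_iff.mpr (hc0 i)
  have hprodpos : 0 < ∏ i, ‖c i‖ := Finset.prod_pos fun i _ => hcpos i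
  have hlog := Real.log_le_log (mul_pos (zpow_pos hp0 m) hgpos) hJ
  rw [Real.log_mul (zpow_pos hp0 m).ne' hgpos.ne', Real.log_zpow,
    Real.log_mul (Real.rpow_pos_of_pos hp0 _).ne' hprodpos.ne', Real.log_rpow hp0,
    Real.log_prod fun i _ => (hcpos i).ne'] at hlog
  -- `H ≥ Σ log‖z_i‖`
  have hH := sum_log_norm_le_packetLogμ_packetHull_logPacket p k hz0 hzΛ
  rw [hvol, Finset.sum_sub_distrib]
  nlinarith [hlog, hH]

end Packet

/-! ## 2. One factor: a shell pair `(c, z)` — largest inner ball, a large element -/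

section Factor

variable (p : ℕ) [hp : Fact p.Prime]
variable {K : Type} [NontriviallyNormedField K] [instK : NormedAlgebra ℚ_[p] K] [IsUltrametricDist K] [ProperSpace K]

include instK in
/-- **A shell pair exists at every factor**, with `log‖z‖ − log‖c‖ ≥ 0`: the largest inner ball `c·𝒪 ⊆ log_p(𝒪^×)` (with its
maximality witness) and a dominating element `z ∈ log_p(𝒪^×)` (abc-iut-W-row-2's `exists_shellRadii_witnesses`; `c = c·1 ∈ log_p(𝒪^×)`
so `‖c‖ ≤ ‖z‖`). [cite: Mochizuki2012, IUTchIV Prop. 1.2 (i) p. 10] -/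
theorem exists_shellPair_nonneg :
    ∃ c z : K, c ≠ 0 ∧ (∀ o : K, ‖o‖ ≤ 1 → c * o ∈ logUnits K) ∧
      (∃ (ϖ : Kˣ) (w : K), IsUniformizer ϖ ∧ w ∉ logUnits K ∧ ‖w‖ * ‖(ϖ : K)‖ ≤ ‖c‖) ∧
      z ≠ 0 ∧ z ∈ logUnits K ∧ 0 ≤ Real.log ‖z‖ - Real.log ‖c‖ := by
  obtain ⟨c, z, hc0, hc, hmax, hz0, hzΛ, hdom⟩ := exists_shellRadii_witnesses p (K := K)
  refine ⟨c, z, hc0, hc, hmax, hz0, hzΛ, ?_⟩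
  have hcΛ : c ∈ logUnits K := by simpa using hc 1 (by simp)
  have hle : ‖c‖ ≤ ‖z‖ := hdom c hcΛ
  have := Real.log_le_log (norm_pos_iff.mpr hc0) hle
  linarith

include instK in
/-- **Off the cyclotomic indices the shell pair pays `(a − (p^a − 1)/e)·log p` for every `a`**: if the ramification index
`e` of `K` is not of the form `p^a·(p − 1)`, then for every `a : ℕ` there is a shell pair `(c, z)` (largest inner ball, `z ∈ log_p(𝒪^×)`
nonzero) with `(a − p^a/e + 1/e)·log p ≤ log‖z‖ − log‖c‖`: the unit ball is never inside `log_p(𝒪^×)` so `‖c‖ ≤ p^{−1/e}`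
(abc-iut-W-row-2), and `z = log_p(1 + ϖ)` has norm `p^{−(p^{a₀} − e·a₀)/e} ≥ p^{a − p^a/e}` (abc-iut-c312-3's envelope at the
strict turning point `a₀`, minimal among the prime-power exponents). [cite: NeukirchANT1999, Ch. II (5.5)]
[cite: Mochizuki2012, IUTchIV Prop. 1.2 (i) p. 10] -/
theorem exists_shellPair_ge_of_forall_ne
    (hne : ∀ a : ℕ, (absRamificationIdx p K : ℤ) ≠ (p : ℤ) ^ a * ((p : ℤ) - 1)) (a : ℕ) :
    ∃ c z : K, c ≠ 0 ∧ (∀ o : K, ‖o‖ ≤ 1 → c * o ∈ logUnits K) ∧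
      (∃ (ϖ : Kˣ) (w : K), IsUniformizer ϖ ∧ w ∉ logUnits K ∧ ‖w‖ * ‖(ϖ : K)‖ ≤ ‖c‖) ∧
      z ≠ 0 ∧ z ∈ logUnits K ∧
      ((a : ℝ) - (p : ℝ) ^ a / absRamificationIdx p K + 1 / absRamificationIdx p K) * Real.log p ≤
        Real.log ‖z‖ - Real.log ‖c‖ := by
  have hpp : p.Prime := hp.out
  have hp1 : (1 : ℝ) < p := by exact_mod_cast hpp.one_lt
  have hp0 : (0 : ℝ) < p := by linarith
  have he : (0 : ℝ) < absRamificationIdx p K := by exact_mod_cast absRamificationIdx_pos p K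
  -- the inner ball
  obtain ⟨c, -, hc0, hc, hmax, -, -, -⟩ := exists_shellRadii_witnesses p (K := K)
  have hcle : ‖c‖ ≤ (p : ℝ) ^ (-(((1 : ℤ) : ℝ) / absRamificationIdx p K)) :=
    norm_le_rpow_of_mul_subset_logUnits p hc (R := 1) (by
      have h1 : ((p : ℝ) ^ (-((((1 : ℤ) : ℝ) - 1) / absRamificationIdx p K))) = 1 := by
        rw [show (((1 : ℤ) : ℝ) - 1) = 0 by norm_num, zero_div, neg_zero, Real.rpow_zero]
      rw [h1]
      exact not_closedBall_one_subset_logUnits p (K := K))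
  -- the large element at the strict turning point
  obtain ⟨a₀, hlo, hhi⟩ := LogEnvelope.exists_strict_turning_of_forall_ne (p := p) hne
  obtain ⟨z, hzΛ, hznorm⟩ := LogEnvelope.exists_mem_logUnits_norm_eq_envelope p (isUniformizer_unifChoice K) hlo hhi
  have hzrpow : ‖z‖ = (p : ℝ) ^ (-((((p : ℤ) ^ a₀ - (absRamificationIdx p K : ℤ) * (a₀ : ℤ) : ℤ) : ℝ) /
      absRamificationIdx p K)) := by
    rw [hznorm, norm_isUniformizer_zpow_eq_rpow p (isUniformizer_unifChoice K)]
  have hzpos : 0 < ‖z‖ := by rw [hzrpow]; exact Real.rpow_pos_of_pos hp0 _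
  have hz0 : z ≠ 0 := norm_pos_iff.mp hzpos
  -- the envelope exponent is below `p^a − e·a`
  have henv : (p : ℤ) ^ a₀ - (absRamificationIdx p K : ℤ) * (a₀ : ℤ) ≤
      (p : ℤ) ^ a - (absRamificationIdx p K : ℤ) * (a : ℤ) := by
    have h := LogEnvelope.envelope_le_index (p := p) (K := K) hlo hhi.le (s := 1) le_rfl (p ^ a - 1)
    have hpa : p ^ a - 1 + 1 = p ^ a := Nat.sub_add_cancel (Nat.one_le_pow _ _ hpp.pos)
    rw [hpa, padicValNat.prime_pow, one_mul] at h
    exact_mod_cast h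
  refine ⟨c, z, hc0, hc, hmax, hz0, hzΛ, ?_⟩
  -- logs
  have hlogc : Real.log ‖c‖ ≤ -(1 / absRamificationIdx p K) * Real.log p := by
    have h := Real.log_le_log (norm_pos_iff.mpr hc0) hcle
    rw [Real.log_rpow hp0] at h
    have : (-(((1 : ℤ) : ℝ) / absRamificationIdx p K)) = -(1 / absRamificationIdx p K) := by push_cast; ring
    rw [this] at h
    exact h
  have hlogz : Real.log ‖z‖ = -((((p : ℤ) ^ a₀ - (absRamificationIdx p K : ℤ) * (a₀ : ℤ) : ℤ) : ℝ) /
      absRamificationIdx p K) * Real.log p := by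
    rw [hzrpow, Real.log_rpow hp0]
  have henvR : ((((p : ℤ) ^ a₀ - (absRamificationIdx p K : ℤ) * (a₀ : ℤ) : ℤ) : ℝ)) ≤
      (p : ℝ) ^ a - (absRamificationIdx p K : ℝ) * a := by exact_mod_cast henv
  have hlogp : 0 < Real.log p := Real.log_pos hp1
  rw [hlogz]
  have hkey : ((a : ℝ) - (p : ℝ) ^ a / absRamificationIdx p K + 1 / absRamificationIdx p K) =
      -(((p : ℝ) ^ a - (absRamificationIdx p K : ℝ) * a) / absRamificationIdx p K) + 1 / absRamificationIdx p K := by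
    field_simp
    ring
  rw [hkey]
  have hdiv : -((((p : ℤ) ^ a₀ - (absRamificationIdx p K : ℤ) * (a₀ : ℤ) : ℤ) : ℝ) / absRamificationIdx p K) ≥
      -(((p : ℝ) ^ a - (absRamificationIdx p K : ℝ) * a) / absRamificationIdx p K) := by
    have := div_le_div_of_nonneg_right henvR he.le
    linarith
  nlinarith [hdiv, hlogc, hlogp]

end Factor

end Literature.IUT.LogVolume

end
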